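/-
Copyright (c) 2026 the pub-hodgecm-mathlib formalisation cell (harness21).  Prover seat hodgecm-mathlib-K2E5-p04 (g3), HCML Track B «K2-LIT» (build stream 29),
h413 = `stmt-HodgeConjecture-24833`, line `K2_E3_EllipticInputs`, unit U12 «Characters», socket #11 road (11-SC), letter (SC-an), END-GAME MAP v3 (line lead
K2E3-p14 (g3)), RULINGS #7 (R7-4) ∕ 03:05:17Z: [M6′] FILE C — the SPLIT-REGULAR `hball` of ★ p856355 for the EXPLICIT ball of ★ [M6′] FILE B, DISCHARGED down to an explicit
shell weight by ★ (M5e-1‴) `exists_const_integral_heightBall_norm_conj_le_shell` with every structural binder of the split-torus bricks paid at `K = L_w`.  2026-09-04.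
-/
import Summits.HodgeConjecture.HodgeConjecture.Theorems.K2E3SupercuspidalTruncatedCharLimCancExplicit  -- ★ [M6′] FILE B p856971 (this seat): `exists_explicit_exhaustion_radius`; brings FILE A, ★ [M6], ★ [M2a], ★ [M5′], ★ (D2), ★ (M5d)
import Summits.HodgeConjecture.HodgeConjecture.Theorems.K2E3SupercuspBallBoundSplitAssembly        -- ★ (M5e-1) p856957∕p856981 (K2E3-p14): `exists_const_integral_heightBall_norm_conj_le_shell`, `v_pow_mul_torus_le_one_of_conj_mem`; brings ★ (M5a), (M5b), (M5e-2)
import Summits.HodgeConjecture.HodgeConjecture.Theorems.K2E3SplitTorusQuotientMeasure                -- ★ (M5a)+ p856961 (K2E3-p20): `exists_isHaarMeasure_torusU`, `exists_smulInvariantMeasure_quotient_torusU_place`, torus instances; brings ★ p856925 `exists_isCompact_subgroup_mul_borelU_of_eq_over`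
import HarnessLib

/-!
# h413 ∕ Track B «K2-LIT», line `K2_E3_EllipticInputs`, unit U12, road (11-SC), letter (SC-an) — [M6′] FILE C: THE SPLIT-REGULAR BALL BOUND ON `U₃(H)(L⁺_v)` FOR THE
# EXPLICIT BALL `Bset g = e⁻¹(Ω_M (R g))`, AS AN EXPLICIT SHELL WEIGHT `C·M·(2(12m_θ + 208 h(e g) + 80τ) + 3)·q^{h(e g)}·T(e g)⁻¹`
# (Harish-Chandra 1970, Part VII §3 pp. 71–72, Theorems 14, 18–20)

Cell `pub/hodgecm-mathlib`, crux H413 = `stmt-HodgeConjecture-24833`, route of record `HCCMUnconditional`; chair K2-lead (g0), dealer K2E3-plan (g2), (SC-an) line lead K2E3-p14 (g3)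
(RULINGS #7 (R7-4) «FILE B: import ★ (M5e-1) for the split `hball_of_model_bound` (binders `hunimod hK₁ hKB` := ★ p856925 §1 + ★ [M2a], `hμQ hρ` := p20's (M5a+))» and
03:05:17Z «this is the head to consume: `exists_const_integral_heightBall_norm_conj_le_shell`»).  THEOREMS ONLY (no `def`, no `instance`, no `notation`, no named-fact hypothesis,
no `sorry`); lane `--supports stmt-HodgeConjecture-24833 --as helper`, count-neutral.

WHAT.  Along a field model `e : G = (cmDatum L 3 H).Local v ≃ₜ* M = U(σ_w, Φ₃)(L_w)` with height balls `Ω_M` (INPUT), for `θ = B u′ (ρ(·) u)` a smooth supercuspidal coefficient on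
`G` and `μ` Haar: the objects of ★ FILE B (`Ω = e⁻¹ Ω_M`, the radius `R`, the support height `m_θ`, `F`, `Bset g = e⁻¹(Ω_M (R g))`, with `hlim`∕`hcanc` of ★ p856184 ∕ ★ p856355
token for token, a.e. regularity of `e g`, `hball_of_model_bound`, `hballE_of_model_bound`) TOGETHER WITH constants `C, M : ℝ≥0` (`‖θ_M‖ ≤ M`) and the **SPLIT BALL BOUND ON `G`**:
for EVERY `g` with `e g` regular and `Z_G(g)` NOT compact, and every shell index `τ` with `‖ϖ‖^τ ≤ T(e g)` (`T` = the line's frozen token `√√(|disc χ| · |det|⁻²)` = `|D|^{1∕2}`),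
  `∫_{Bset g} ‖θ(x g x⁻¹)‖ dμ ≤ C · M · (2(12 m_θ + 208 h + 80 τ + 1) + 1) · q^{h} · T(e g)⁻¹`,   `h := Ω_M.find (e g)` (the MINIMAL height, Mathlib `CompactExhaustion.find`).
HOW.  ★ FILE B's datum `(t, d, y₀, λ_min, m_g)` at `e g` (`m_g = h` by minimality; `R g = 5(2m_θ + 2λ_min) + 3(2m_g + 2λ_min) + 1`); on the shell, `t` has depth `4τ + 10 m_g`
(★ `v_pow_mul_torus_le_one_of_conj_mem`, ★ (M5e-2) `v_pow_le_v_sub_of_pow_normAbs_le_token`), so `λ_min ≤ 4τ + 10m_g` and `R g + 42m_g + 2m_θ + 16τ ≤ 12m_θ + 208m_g + 80τ + 1`;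
★ (M5e-1‴) `exists_const_integral_heightBall_norm_conj_le_shell` on `M` at `(e_* μ, Ω_M, θ_M, ⟨t⟩, d, e g, y₀, m_g, τ, R g)` with its binders DISCHARGED at `L_w` — `hunimod` (★ [M2a]
FILE A (c)), `K₁, hKB` (★ p856925 `exists_isCompact_subgroup_mul_borelU_of_eq_over`), `ρ_T` (★ `exists_isHaarMeasure_torusU`), `μQ ≠ 0` (★ `exists_smulInvariantMeasure_quotient_torusU_place`),
`σ_w ≠ id` (★ `exists_skew_ne_zero_adicCompletion`), countability ∕ local compactness (★ [M2a] FILE A (b)); transport `G ← M` by ★ FILE B (f).  After this file the only open inputs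
of (SC-dom) at `N = 3` are the ELLIPTIC full-orbital bound (M5f) (for `hballE` and the compact-centraliser part of `hball`), the weight packaging `W(g) ≍ T⁻¹(1 + |log_q T|)` with its
measurability ((M5h)), and `hW` ((M5g) HC-D-ε).

* **`explicit_localisation_and_split_ball_bound`** — the single ∃-statement above (one choice of `Ω R m_θ F Bset C M` for all clauses).

HONEST LABEL.  HC_CM is proved only modulo the 7 printed citations (2 remaining named inputs: hLiu418 = `stmt-HodgeConjecture-24832`, h413 = `stmt-HodgeConjecture-24833`)
until rung 0 closes; count-neutral helper ((SC-an) is NOT ★: (M5f), (M5h), (M5g) open).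

## References
* [HarishChandra1970] Harish-Chandra (notes by G. van Dijk), *Harmonic Analysis on Reductive p-adic Groups*, LNM 162 (1970), Part VI §8 Theorem 14 p. 60; Part VII §2 p. 69,
  Theorems 18–20 pp. 69–70; §3 pp. 71–72.
* [Rogawski1990] J. D. Rogawski, *Automorphic Representations of Unitary Groups in Three Variables*, Ann. of Math. Stud. 123 (1990), §3.1 p. 19, §4.9 p. 54, §7.3 p. 97, §12.2 p. 173.
* [DeitmarEchterhoff2014] A. Deitmar, S. Echterhoff, *Principles of Harmonic Analysis*, 2nd ed. (2014), Thm. 1.5.3.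
* [Folland1995] G. B. Folland, *A Course in Abstract Harmonic Analysis* (1995), §2.4, §2.6.
-/

set_option autoImplicit false
-- the mandated namespace repeats the single-problem summit's segment (`HodgeConjecture.HodgeConjecture`)
set_option linter.dupNamespace false

noncomputable section

open MeasureTheory Measure Set Filter Topology NumberField IsDedekindDomain
open scoped NNReal ENNReal Pointwise Matrix MatrixGroups WithZero
open ValuativeRel
open Literature.NumberTheory.Automorphic Literature.NumberTheory.Automorphic.UnitaryGroup Literature.NumberTheory.Rogawski1990
open Literature.NumberTheory.GaloisRepresentations Literature.NumberTheory.GaloisRepresentations.IsNonarchimedeanLocalField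

namespace Summit.HodgeConjecture.HodgeConjecture.Cruxes.H413.K2E3SupercuspidalTruncatedCharSplitBallPlace

variable (L : Type) [Field L] [NumberField L] [IsCMField L] (H : Matrix (Fin 3) (Fin 3) L)

set_option maxHeartbeats 800000 in
-- the statement is long (eleven exported clauses on the CM ∕ one-place carriers); default budget runs out in its elaboration (same class as ★ [M6′] FILE B)
/-- **[M6′] FILE C — THE EXPLICIT LOCALISATION TOGETHER WITH THE SPLIT-REGULAR BALL BOUND AS AN EXPLICIT SHELL WEIGHT.**  Along `e : (cmDatum L 3 H).Local v ≃ₜ* U(σ_w, Φ₃)(L_w)`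
with height balls `Ω_M` (`hmem` `hinv` `hmul`), for a smooth supercuspidal `ρ` with invariant `B`, `θ = B u′ (ρ(·) u)`, `θ_M = θ ∘ e⁻¹`, and `μ` Haar: ONE choice of
`Ω (= e⁻¹ Ω_M)`, `R`, `m_θ`, `F`, `Bset (= e⁻¹(Ω_M (R ·)))`, `C`, `M` with — `hBsetc`, `hlim`, `hcanc` (★ p856184 ∕ ★ p856355 token for token), `supp θ_M ⊆ Ω_M m_θ`, `‖θ_M‖₊ ≤ M`,
`e g` regular a.e., `hball_of_model_bound` ∕ `hballE_of_model_bound` (`W := W_M ∘ e`, as ★ FILE B), AND **the split ball bound**: for every `g` with `e g` regular and `Z_G(g)` not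
compact and every `τ` with `‖ϖ‖^τ ≤ T(e g)`, `∫_{Bset g} ‖θ(x g x⁻¹)‖ dμ ≤ C·M·(2(12m_θ + 208·h + 80τ + 1) + 1)·q^{h}·T(e g)⁻¹`, `h = Ω_M.find (e g)`.  ★ FILE B ∘ ★ (M5e-1‴) with the
binders of the split-torus bricks discharged at `L_w` (★ [M2a], ★ p856925, ★ p856961, ★ `exists_skew_ne_zero_adicCompletion`).
[cite: HarishChandra1970, Part VII §3 pp. 71–72; §2 Theorems 18–20 pp. 69–70; Part VI §8 Theorem 14 p. 60] [cite: Rogawski1990, §4.9 p. 54, §7.3 p. 97] [cite: DeitmarEchterhoff2014, Thm. 1.5.3] -/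
theorem explicit_localisation_and_split_ball_bound
    {v : HeightOneSpectrum (𝓞 ↥(maximalRealSubfield L))} (w : PlacesOver L v) (hw : IsCMField.complexConj L • w.1 = w.1)
    [MeasurableSpace ((UnitaryGroup.cmDatum L 3 H).Local v)] [BorelSpace ((UnitaryGroup.cmDatum L 3 H).Local v)]
    (μ : Measure ((UnitaryGroup.cmDatum L 3 H).Local v)) [μ.IsHaarMeasure]
    [MeasurableSpace ↥(unitaryGroupOfForm (galAdicCompletionMap (L := L) (IsCMField.complexConj L) hw) ((StdForm.antidiagonal 3).over (w.1.adicCompletion L)))]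
    [BorelSpace ↥(unitaryGroupOfForm (galAdicCompletionMap (L := L) (IsCMField.complexConj L) hw) ((StdForm.antidiagonal 3).over (w.1.adicCompletion L)))]
    (e : (UnitaryGroup.cmDatum L 3 H).Local v ≃ₜ*
      ↥(unitaryGroupOfForm (galAdicCompletionMap (L := L) (IsCMField.complexConj L) hw) ((StdForm.antidiagonal 3).over (w.1.adicCompletion L))))
    (ΩM : CompactExhaustion ↥(unitaryGroupOfForm (galAdicCompletionMap (L := L) (IsCMField.complexConj L) hw) ((StdForm.antidiagonal 3).over (w.1.adicCompletion L))))
    {ϖ : w.1.adicCompletion L} (hϖ : Valued.v ϖ = WithZero.exp (-1 : ℤ))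
    (hmem : ∀ (m : ℕ) (g : ↥(unitaryGroupOfForm (galAdicCompletionMap (L := L) (IsCMField.complexConj L) hw) ((StdForm.antidiagonal 3).over (w.1.adicCompletion L)))),
      g ∈ ΩM m ↔
      (∀ i j, Valued.v (ϖ ^ m * ((g : GL (Fin 3) (w.1.adicCompletion L)) : Matrix (Fin 3) (Fin 3) (w.1.adicCompletion L)) i j) ≤ 1) ∧
        ∀ i j, Valued.v (ϖ ^ m * (((g : GL (Fin 3) (w.1.adicCompletion L))⁻¹ : GL (Fin 3) (w.1.adicCompletion L)) :
          Matrix (Fin 3) (Fin 3) (w.1.adicCompletion L)) i j) ≤ 1)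
    (hinv : ∀ (m : ℕ) (g : ↥(unitaryGroupOfForm (galAdicCompletionMap (L := L) (IsCMField.complexConj L) hw) ((StdForm.antidiagonal 3).over (w.1.adicCompletion L)))),
      g ∈ ΩM m → g⁻¹ ∈ ΩM m)
    (hmul : ∀ (a b : ℕ) (g h : ↥(unitaryGroupOfForm (galAdicCompletionMap (L := L) (IsCMField.complexConj L) hw) ((StdForm.antidiagonal 3).over (w.1.adicCompletion L)))),
      g ∈ ΩM a → h ∈ ΩM b → g * h ∈ ΩM (a + b))
    {V : Type*} [AddCommGroup V] [Module ℂ V] (ρ : Representation ℂ ((UnitaryGroup.cmDatum L 3 H).Local v) V) (hsm : ρ.IsSmooth) (hsc : ρ.IsSupercuspidal)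
    (B : V →ₗ⋆[ℂ] V →ₗ[ℂ] ℂ) (hBinv : ∀ (g : (UnitaryGroup.cmDatum L 3 H).Local v) (x y : V), B (ρ g x) (ρ g y) = B x y) (u u' : V) :
    ∃ (Ω : CompactExhaustion ((UnitaryGroup.cmDatum L 3 H).Local v)) (R : (UnitaryGroup.cmDatum L 3 H).Local v → ℕ) (mθ : ℕ)
      (F : (UnitaryGroup.cmDatum L 3 H).Local v → ℂ) (Bset : (UnitaryGroup.cmDatum L 3 H).Local v → Set ((UnitaryGroup.cmDatum L 3 H).Local v)) (C M : ℝ≥0),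
      (∀ n : ℕ, (Ω n : Set ((UnitaryGroup.cmDatum L 3 H).Local v)) = e ⁻¹' (ΩM n)) ∧
      (∀ g, Bset g = e ⁻¹' (ΩM (R g))) ∧ (∀ g, IsCompact (Bset g)) ∧
      -- `hlim` of ★ p856184 and `hcanc` of ★ p856355, token for token
      (∀ᵐ g ∂μ, ¬ (IsRegularElt (g.val : GL (Fin 3) (UnitaryGroup.LocalRing L v)) ∧
          IsCompact ((Subgroup.centralizer ({g} : Set ((UnitaryGroup.cmDatum L 3 H).Local v))) : Set ((UnitaryGroup.cmDatum L 3 H).Local v))) →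
        Tendsto (fun n => ∫ x in Ω n, B u' (ρ (x * g * x⁻¹) u) ∂μ) atTop (𝓝 (F g))) ∧
      (∀ n : ℕ, ∀ᵐ g ∂μ, ¬ (IsRegularElt (g.val : GL (Fin 3) (UnitaryGroup.LocalRing L v)) ∧
          IsCompact ((Subgroup.centralizer ({g} : Set ((UnitaryGroup.cmDatum L 3 H).Local v))) : Set ((UnitaryGroup.cmDatum L 3 H).Local v))) →
        ∫ x in Ω n, B u' (ρ (x * g * x⁻¹) u) ∂μ = ∫ x in Ω n ∩ Bset g, B u' (ρ (x * g * x⁻¹) u) ∂μ) ∧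
      -- support height and bound of `θ_M = θ ∘ e⁻¹`, a.e. regularity of `e g`
      (∀ m' : ↥(unitaryGroupOfForm (galAdicCompletionMap (L := L) (IsCMField.complexConj L) hw) ((StdForm.antidiagonal 3).over (w.1.adicCompletion L))),
        B u' (ρ (e.symm m') u) ≠ 0 → m' ∈ ΩM mθ) ∧
      (∀ m' : ↥(unitaryGroupOfForm (galAdicCompletionMap (L := L) (IsCMField.complexConj L) hw) ((StdForm.antidiagonal 3).over (w.1.adicCompletion L))),
        ‖B u' (ρ (e.symm m') u)‖₊ ≤ M) ∧
      (∀ᵐ g ∂μ, IsRegularElt ((e g : ↥(unitaryGroupOfForm (galAdicCompletionMap (L := L) (IsCMField.complexConj L) hw)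
          ((StdForm.antidiagonal 3).over (w.1.adicCompletion L)))) : GL (Fin 3) (w.1.adicCompletion L))) ∧
      -- `hball_of_model_bound` and `hballE_of_model_bound` (`W := W_M ∘ e`), as ★ FILE B
      (∀ W_M : ↥(unitaryGroupOfForm (galAdicCompletionMap (L := L) (IsCMField.complexConj L) hw) ((StdForm.antidiagonal 3).over (w.1.adicCompletion L))) → ℝ,
        (∀ᵐ g ∂μ, ¬ (IsRegularElt (g.val : GL (Fin 3) (UnitaryGroup.LocalRing L v)) ∧
            IsCompact ((Subgroup.centralizer ({g} : Set ((UnitaryGroup.cmDatum L 3 H).Local v))) : Set ((UnitaryGroup.cmDatum L 3 H).Local v))) →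
          ∫ x' in ΩM (R g), ‖B u' (ρ (e.symm (x' * e g * x'⁻¹)) u)‖ ∂(μ.map e) ≤ W_M (e g)) →
        ∀ᵐ g ∂μ, ¬ (IsRegularElt (g.val : GL (Fin 3) (UnitaryGroup.LocalRing L v)) ∧
            IsCompact ((Subgroup.centralizer ({g} : Set ((UnitaryGroup.cmDatum L 3 H).Local v))) : Set ((UnitaryGroup.cmDatum L 3 H).Local v))) →
          ∫ x in Bset g, ‖B u' (ρ (x * g * x⁻¹) u)‖ ∂μ ≤ W_M (e g)) ∧
      (∀ W_M : ↥(unitaryGroupOfForm (galAdicCompletionMap (L := L) (IsCMField.complexConj L) hw) ((StdForm.antidiagonal 3).over (w.1.adicCompletion L))) → ℝ,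
        (∀ᵐ g ∂μ, (IsRegularElt (g.val : GL (Fin 3) (UnitaryGroup.LocalRing L v)) ∧
            IsCompact ((Subgroup.centralizer ({g} : Set ((UnitaryGroup.cmDatum L 3 H).Local v))) : Set ((UnitaryGroup.cmDatum L 3 H).Local v))) →
          ∫ x', ‖B u' (ρ (e.symm (x' * e g * x'⁻¹)) u)‖ ∂(μ.map e) ≤ W_M (e g)) →
        ∀ᵐ g ∂μ, (IsRegularElt (g.val : GL (Fin 3) (UnitaryGroup.LocalRing L v)) ∧
            IsCompact ((Subgroup.centralizer ({g} : Set ((UnitaryGroup.cmDatum L 3 H).Local v))) : Set ((UnitaryGroup.cmDatum L 3 H).Local v))) →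
          ∫ x, ‖B u' (ρ (x * g * x⁻¹) u)‖ ∂μ ≤ W_M (e g)) ∧
      -- THE SPLIT BALL BOUND, explicit shell weight (★ (M5e-1‴) at the place, for the chosen ball)
      (∀ g : (UnitaryGroup.cmDatum L 3 H).Local v, IsRegularElt ((e g : ↥(unitaryGroupOfForm (galAdicCompletionMap (L := L) (IsCMField.complexConj L) hw)
          ((StdForm.antidiagonal 3).over (w.1.adicCompletion L)))) : GL (Fin 3) (w.1.adicCompletion L)) →
        ¬ IsCompact ((Subgroup.centralizer ({g} : Set ((UnitaryGroup.cmDatum L 3 H).Local v))) : Set ((UnitaryGroup.cmDatum L 3 H).Local v)) →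
        ∀ τ : ℕ, normAbs (w.1.adicCompletion L) ϖ ^ τ ≤ NNReal.sqrt (NNReal.sqrt
            (normAbs (w.1.adicCompletion L) ((((e g : ↥(unitaryGroupOfForm (galAdicCompletionMap (L := L) (IsCMField.complexConj L) hw)
                ((StdForm.antidiagonal 3).over (w.1.adicCompletion L)))) : GL (Fin 3) (w.1.adicCompletion L)) : Matrix (Fin 3) (Fin 3) (w.1.adicCompletion L))).charpoly.discr *
              (normAbs (w.1.adicCompletion L) ((((e g : ↥(unitaryGroupOfForm (galAdicCompletionMap (L := L) (IsCMField.complexConj L) hw)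
                ((StdForm.antidiagonal 3).over (w.1.adicCompletion L)))) : GL (Fin 3) (w.1.adicCompletion L)) : Matrix (Fin 3) (Fin 3) (w.1.adicCompletion L))).det ^ 2)⁻¹)) →
          ∫ x in Bset g, ‖B u' (ρ (x * g * x⁻¹) u)‖ ∂μ ≤
            C * M * ((2 * (12 * mθ + 208 * ΩM.find (e g) + 80 * τ + 1) + 1 : ℕ) : ℝ) *
              ((residueFieldCard (w.1.adicCompletion L) : ℝ≥0) : ℝ) ^ (ΩM.find (e g)) *
              ((NNReal.sqrt (NNReal.sqrt
                (normAbs (w.1.adicCompletion L) ((((e g : ↥(unitaryGroupOfForm (galAdicCompletionMap (L := L) (IsCMField.complexConj L) hw)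
                    ((StdForm.antidiagonal 3).over (w.1.adicCompletion L)))) : GL (Fin 3) (w.1.adicCompletion L)) : Matrix (Fin 3) (Fin 3) (w.1.adicCompletion L))).charpoly.discr *
                  (normAbs (w.1.adicCompletion L) ((((e g : ↥(unitaryGroupOfForm (galAdicCompletionMap (L := L) (IsCMField.complexConj L) hw)
                    ((StdForm.antidiagonal 3).over (w.1.adicCompletion L)))) : GL (Fin 3) (w.1.adicCompletion L)) : Matrix (Fin 3) (Fin 3) (w.1.adicCompletion L))).det ^ 2)⁻¹)))⁻¹ : ℝ)) := by
  -- ★ FILE B MAIN: `Ω`, `R`, `m_θ`, the shapes, the datum, a.e. regularity, the transport identity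
  obtain ⟨Ω, R, mθ, hΩ, hθ, hae, hdat, hregae, htrans⟩ :=
    K2E3SupercuspidalTruncatedCharLimCancExplicit.exists_explicit_exhaustion_radius L H w hw μ e ΩM hϖ hmem hinv hmul ρ hsm hsc B hBinv u u'
  have hBset : ∀ g, (Ω (R g) : Set ((UnitaryGroup.cmDatum L 3 H).Local v)) = e ⁻¹' (ΩM (R g)) := fun g => hΩ (R g)
  -- the model coefficient `θ_M`: continuous, supported in `Ω_M m_θ`, hence bounded
  have hθMc : Continuous fun m' : ↥(unitaryGroupOfForm (galAdicCompletionMap (L := L) (IsCMField.complexConj L) hw) ((StdForm.antidiagonal 3).over (w.1.adicCompletion L))) =>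
      B u' (ρ (e.symm m') u) := (Representation.continuous_sesqForm_apply_apply (hsm u) u').comp e.symm.continuous
  have hθMcs : HasCompactSupport fun m' : ↥(unitaryGroupOfForm (galAdicCompletionMap (L := L) (IsCMField.complexConj L) hw)
      ((StdForm.antidiagonal 3).over (w.1.adicCompletion L))) => B u' (ρ (e.symm m') u) :=
    HasCompactSupport.intro (ΩM.isCompact mθ) fun m' hm' => not_not.1 fun h => hm' (hθ m' h)
  obtain ⟨M₀, hM₀⟩ := hθMcs.exists_bound_of_continuous hθMc
  have hMb : ∀ m' : ↥(unitaryGroupOfForm (galAdicCompletionMap (L := L) (IsCMField.complexConj L) hw) ((StdForm.antidiagonal 3).over (w.1.adicCompletion L))),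
      ‖B u' (ρ (e.symm m') u)‖₊ ≤ Real.toNNReal M₀ := fun m' => by
    rw [← NNReal.coe_le_coe, coe_nnnorm]
    exact (hM₀ m').trans (Real.le_coe_toNNReal M₀)
  -- the frame of `L_w` and `M`, and the binders of the split-torus bricks at the place
  letI : MeasurableSpace (w.1.adicCompletion L) := borel _
  haveI : BorelSpace (w.1.adicCompletion L) := ⟨rfl⟩
  haveI : SecondCountableTopology (w.1.adicCompletion L) := secondCountableTopology_adicCompletion L w.1
  haveI : CharZero (w.1.adicCompletion L) := charZero_of_injective_algebraMap (algebraMap L (w.1.adicCompletion L)).injective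
  haveI : SecondCountableTopology ↥(unitaryGroupOfForm (galAdicCompletionMap (L := L) (IsCMField.complexConj L) hw) ((StdForm.antidiagonal 3).over (w.1.adicCompletion L))) :=
    K2E3SupercuspModelFrameAtPlace.secondCountableTopology_unitaryGroupOfForm_adicCompletion L w _ _
  haveI : LocallyCompactSpace ↥(unitaryGroupOfForm (galAdicCompletionMap (L := L) (IsCMField.complexConj L) hw) ((StdForm.antidiagonal 3).over (w.1.adicCompletion L))) :=
    K2E3SupercuspModelFrameAtPlace.locallyCompactSpace_unitaryGroupOfForm_adicCompletion L w hw _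
  haveI : (μ.map e).IsHaarMeasure := ContinuousMulEquiv.isHaarMeasure_map μ e
  haveI : (μ.map e).IsMulRightInvariant := K2E3SupercuspModelFrameAtPlace.isMulRightInvariant_of_isHaarMeasure_of_eq_over L w hw rfl (μ.map e)
  have hσσ : ∀ x, galAdicCompletionMap (L := L) (IsCMField.complexConj L) hw (galAdicCompletionMap (L := L) (IsCMField.complexConj L) hw x) = x :=
    galAdicCompletionMap_galAdicCompletionMap_of_smul_eq (IsCMField.complexConj L) w (IsCMField.complexConj_ne_one L) hw
  have hσc : Continuous (galAdicCompletionMap (L := L) (IsCMField.complexConj L) hw) := continuous_galAdicCompletionMap L (IsCMField.complexConj L) hw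
  have hσv : ∀ x, Valued.v (galAdicCompletionMap (L := L) (IsCMField.complexConj L) hw x) = Valued.v x :=
    fun x => valued_galAdicCompletionMap (L := L) (IsCMField.complexConj L) hw x
  have hσ1 : ∃ x, galAdicCompletionMap (L := L) (IsCMField.complexConj L) hw x ≠ x := by
    obtain ⟨δ, hσδ, hδ⟩ := exists_skew_ne_zero_adicCompletion (IsCMField.complexConj L) (IsCMField.complexConj_ne_one L) w hw
    refine ⟨δ, fun hfix => hδ ?_⟩
    have h2 : (2 : w.1.adicCompletion L) * δ = 0 := by linear_combination hfix.symm.trans hσδ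
    exact (mul_eq_zero.mp h2).resolve_left two_ne_zero
  -- the torus, its Haar measure, the quotient measure, the Iwasawa compact
  haveI := K2E3SplitTorusQuotientMeasure.locallyCompactSpace_torusU (galAdicCompletionMap (L := L) (IsCMField.complexConj L) hw)
    ((StdForm.antidiagonal 3).over (w.1.adicCompletion L))
  haveI := K2E3SplitTorusQuotientMeasure.secondCountableTopology_torusU (galAdicCompletionMap (L := L) (IsCMField.complexConj L) hw)
    ((StdForm.antidiagonal 3).over (w.1.adicCompletion L))
  obtain ⟨ρT, hρT⟩ := K2E3SplitTorusQuotientMeasure.exists_isHaarMeasure_torusU (galAdicCompletionMap (L := L) (IsCMField.complexConj L) hw)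
    ((StdForm.antidiagonal 3).over (w.1.adicCompletion L))
  haveI := hρT
  have hρ0 : ρT ≠ 0 := fun h => by
    have h1 := (isOpen_univ (X := ↥(torusU (galAdicCompletionMap (L := L) (IsCMField.complexConj L) hw) ((StdForm.antidiagonal 3).over (w.1.adicCompletion L))))).measure_ne_zero
      ρT Set.univ_nonempty
    rw [h] at h1
    exact h1 rfl
  letI : MeasurableSpace (↥(unitaryGroupOfForm (galAdicCompletionMap (L := L) (IsCMField.complexConj L) hw) ((StdForm.antidiagonal 3).over (w.1.adicCompletion L))) ⧸
      torusU (galAdicCompletionMap (L := L) (IsCMField.complexConj L) hw) ((StdForm.antidiagonal 3).over (w.1.adicCompletion L))) := borel _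
  haveI : BorelSpace (↥(unitaryGroupOfForm (galAdicCompletionMap (L := L) (IsCMField.complexConj L) hw) ((StdForm.antidiagonal 3).over (w.1.adicCompletion L))) ⧸
      torusU (galAdicCompletionMap (L := L) (IsCMField.complexConj L) hw) ((StdForm.antidiagonal 3).over (w.1.adicCompletion L))) := ⟨rfl⟩
  obtain ⟨μQ, hQinv, hQfin, hQ0⟩ := K2E3SplitTorusQuotientMeasure.exists_smulInvariantMeasure_quotient_torusU_place L w hw
    (J := (StdForm.antidiagonal 3).over (w.1.adicCompletion L)) rfl
  haveI := hQinv
  haveI := hQfin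
  obtain ⟨K₁, hK₁, hKB⟩ := K2E3SplitTorusOrbitalBoundPlace.exists_isCompact_subgroup_mul_borelU_of_eq_over L w hw
    (J := (StdForm.antidiagonal 3).over (w.1.adicCompletion L)) rfl
  -- ★ (M5e-1‴): ONE constant for `m_θ`
  obtain ⟨C, hC⟩ := K2E3SupercuspBallBoundSplitAssembly.exists_const_integral_heightBall_norm_conj_le_shell
    (galAdicCompletionMap (L := L) (IsCMField.complexConj L) hw) hσv rfl hσσ hσc hσ1 two_ne_zero hϖ (μ.map e) ρT μQ ΩM hmem hinv hmul
    (fun ν hν => K2E3SupercuspModelFrameAtPlace.isMulRightInvariant_of_isHaarMeasure_of_eq_over L w hw rfl ν) hK₁ hKB hQ0 hρ0 mθ (E := ℂ)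
  refine ⟨Ω, R, mθ, fun g => ∫ x in Ω (R g), B u' (ρ (x * g * x⁻¹) u) ∂μ, fun g => Ω (R g), C, Real.toNNReal M₀, hΩ, hBset, fun g => Ω.isCompact (R g), ?_, fun n => ?_,
    hθ, hMb, hregae, fun W_M hWM => ?_, fun W_M hWM => ?_, fun g hreg hZ τ hτ => ?_⟩
  · filter_upwards [hae] with g hg _
    exact hg.2
  · filter_upwards [hae] with g hg _
    exact hg.1 n
  · filter_upwards [hWM] with g hg hng
    rw [hBset g, htrans g]
    exact hg hng
  · filter_upwards [hWM] with g hg hell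
    have h := htrans g Set.univ
    rw [Set.preimage_univ, Measure.restrict_univ, Measure.restrict_univ] at h
    rw [h]
    exact hg hell
  · -- the datum at `e g` and `m_g = h(e g)`
    obtain ⟨t, y₀, d, lam, mg, hd, -, -, hlam_min, hgm, hmg_min, -, hgy, hR⟩ := hdat g hreg hZ
    have hmg : mg = ΩM.find (e g) := le_antisymm (hmg_min _ (ΩM.mem_find _)) (ΩM.mem_iff_find_le.1 hgm)
    subst hmg
    have htT : t ∈ torusU (galAdicCompletionMap (L := L) (IsCMField.complexConj L) hw) ((StdForm.antidiagonal 3).over (w.1.adicCompletion L)) :=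
      (mem_torusU_iff t).2 ⟨d, hd⟩
    -- the depth of `t` on the shell: `λ_min ≤ 4τ + 10 m_g` (★ `v_pow_mul_torus_le_one_of_conj_mem`, ★ (M5e-2))
    have hgt : y₀ * t * y₀⁻¹ ∈ ΩM (ΩM.find (e g)) := by rw [← hgy]; exact hgm
    have hdm := fun i => (K2E3SupercuspBallBoundSplitAssembly.v_pow_mul_torus_le_one_of_conj_mem (galAdicCompletionMap (L := L) (IsCMField.complexConj L) hw) hσv rfl
      hϖ ΩM hmem hd hgt i).1
    have hdm' := fun i => (K2E3SupercuspBallBoundSplitAssembly.v_pow_mul_torus_le_one_of_conj_mem (galAdicCompletionMap (L := L) (IsCMField.complexConj L) hw) hσv rfl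
      hϖ ΩM hmem hd hgt i).2
    have hcoe : ((e g : ↥(unitaryGroupOfForm (galAdicCompletionMap (L := L) (IsCMField.complexConj L) hw) ((StdForm.antidiagonal 3).over (w.1.adicCompletion L)))) :
        GL (Fin 3) (w.1.adicCompletion L)) =
        (y₀ : GL (Fin 3) (w.1.adicCompletion L)) * (glDiagonal 3 (w.1.adicCompletion L) d : GL (Fin 3) (w.1.adicCompletion L)) * (y₀ : GL (Fin 3) (w.1.adicCompletion L))⁻¹ := by
      rw [hgy, hd]; rfl
    have hchar : ((((e g : ↥(unitaryGroupOfForm (galAdicCompletionMap (L := L) (IsCMField.complexConj L) hw) ((StdForm.antidiagonal 3).over (w.1.adicCompletion L)))) :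
        GL (Fin 3) (w.1.adicCompletion L)) : Matrix (Fin 3) (Fin 3) (w.1.adicCompletion L))).charpoly =
        (((glDiagonal 3 (w.1.adicCompletion L) d : GL (Fin 3) (w.1.adicCompletion L)) : Matrix (Fin 3) (Fin 3) (w.1.adicCompletion L))).charpoly := by
      rw [hcoe, Units.val_mul, Units.val_mul, Matrix.coe_units_inv]
      exact Matrix.charpoly_units_conj (y₀ : GL (Fin 3) (w.1.adicCompletion L)) _
    have hdet : ((((e g : ↥(unitaryGroupOfForm (galAdicCompletionMap (L := L) (IsCMField.complexConj L) hw) ((StdForm.antidiagonal 3).over (w.1.adicCompletion L)))) :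
        GL (Fin 3) (w.1.adicCompletion L)) : Matrix (Fin 3) (Fin 3) (w.1.adicCompletion L))).det =
        (((glDiagonal 3 (w.1.adicCompletion L) d : GL (Fin 3) (w.1.adicCompletion L)) : Matrix (Fin 3) (Fin 3) (w.1.adicCompletion L))).det := by
      rw [hcoe, Units.val_mul, Units.val_mul]
      exact Matrix.det_units_conj (y₀ : GL (Fin 3) (w.1.adicCompletion L)) _
    have hτ' := hτ
    rw [hchar, hdet] at hτ'
    have hdepth : ∀ i k : Fin 3, i ≠ k → Valued.v (ϖ ^ (4 * τ + 10 * ΩM.find (e g))) ≤ Valued.v ((d i : w.1.adicCompletion L) - d k) := fun i k hik =>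
      K2E3SplitTorusDepthFromDiscriminant.v_pow_le_v_sub_of_pow_normAbs_le_token hϖ hdm hdm' hτ' hik
    have hlam : lam ≤ 4 * τ + 10 * ΩM.find (e g) := hlam_min _ hdepth
    have hN : (2 * (R g + 42 * ΩM.find (e g) + 2 * mθ + 16 * τ) + 1 : ℕ) ≤ 2 * (12 * mθ + 208 * ΩM.find (e g) + 80 * τ + 1) + 1 := by
      rw [hR]; omega
    have hN' := (Nat.cast_le (α := ℝ)).2 hN
    -- the shell bound on `M` at `(θ_M, ⟨t⟩, d, e g, y₀, m_g, τ, R g)`, transported to `G`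
    have hshell := hC (fun m' => B u' (ρ (e.symm m') u)) hθMc hθ (Real.toNNReal M₀) hMb ⟨t, htT⟩ d hd (e g) y₀ (ΩM.find (e g)) hgm hgy τ hτ (R g)
    dsimp only
    rw [hBset g, htrans g]
    refine hshell.trans ?_
    have h1 : (0 : ℝ) ≤ (C : ℝ) * (Real.toNNReal M₀ : ℝ) := mul_nonneg C.2 (Real.toNNReal M₀).2
    have h2 : (0 : ℝ) ≤ ((residueFieldCard (w.1.adicCompletion L) : ℝ≥0) : ℝ) ^ ΩM.find (e g) := pow_nonneg (NNReal.coe_nonneg _) _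
    exact mul_le_mul_of_nonneg_right (mul_le_mul_of_nonneg_right (mul_le_mul_of_nonneg_left hN' h1) h2) (inv_nonneg.2 (NNReal.coe_nonneg _))

end Summit.HodgeConjecture.HodgeConjecture.Cruxes.H413.K2E3SupercuspidalTruncatedCharSplitBallPlace

end
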